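import Summits.ValiantsHypothesis.ValiantsHypothesis.Theorems.SymPencilPerFourHessianToric
import Summits.ValiantsHypothesis.ValiantsHypothesis.Theorems.SymPencilPerFourBlocksThree

/-!
# Route `SymPencil` — Case B3 (a rank-`3` row with a zero cell) in ANY dimension: the column of
# the zero cell dies and the row-kernel is perm-isotropic of codimension `3`
# (`--supports` stmt-ValiantsHypothesis-5674 `SdcSuperquadratic`; dimension-free extraction of
# steps (1)–(4) of `SymPencilPerFourSixDimZeroCellSix.rows_or_cross_of_zero_cell_six`, for the
# size-`27` cell `(11, 5, 4)`)

Setting (val-width-5674-p2's Case B3): `W ⊆ K^{4×4}` with H3 (all `3 × 3` subpermanents vanish),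
the per-direction family with `< 6` squares, a cell `(a, m₁) ≡ 0` on `W` while row `a` realises
every `v` with `v_{m₁} = 0`.  `rows_or_cross_of_zero_cell_six` concluded "two rows or a cross"
when `dim W = 6`; its first steps do not use the dimension and are exactly what the dimension-`5`
analysis of the cell `(11, 5, 4)` starts from (crux workfile `Cruxes/SdcSuperquadratic/TORIC-SIX.md`
§X (d)):

**Theorem** (`zero_cell_structure`).  In the setting above:
(1) the whole column `m₁` vanishes on `W`;
(2) every `y ∈ W` with row `a` zero has ALL `2 × 2` subpermanents zero;
(3) `dim (W ∩ {row a = 0}) + 3 = dim W`.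
So at `dim W = 5` the row-kernel `W₀` is a `2`-dimensional perm-isotropic space of `3 × 3`
matrices (rows `≠ a`, columns `≠ m₁`) — `finrank_rowKernel_of_five`.

Honest framing: a structural brick; `27 ≤ sdc(per₄) ≤ 29` unchanged, the crux `SdcSuperquadratic`
and `VP ≠ VNP` untouched.  No definitions, no named facts. [folklore]
-/

noncomputable section

-- single-conjunct layout: Sub = Summit, duplicated namespace component intended
set_option linter.dupNamespace false

namespace Summit.ValiantsHypothesis.ValiantsHypothesis.Theorems.SymPencilPerFourZeroCellStructure

open Matrix MvPolynomial Finset Module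
open Literature.Computability.AlgebraicComplexity
open Literature.Computability.AlgebraicComplexity.AlperBogartVelasco
open Summit.ValiantsHypothesis.ValiantsHypothesis.Theorems.SymPencilPerFourHessianMinors
open Summit.ValiantsHypothesis.ValiantsHypothesis.Theorems.SymPencilPerFourHessianRowControl
open Summit.ValiantsHypothesis.ValiantsHypothesis.Theorems.SymPencilPerFourHessianColControl
open Summit.ValiantsHypothesis.ValiantsHypothesis.Theorems.SymPencilPerFourHessianRankThreeProp
open Summit.ValiantsHypothesis.ValiantsHypothesis.Theorems.SymPencilPerFourHessianRankThreeZero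
open Summit.ValiantsHypothesis.ValiantsHypothesis.Theorems.SymPencilPerFourHessianToric
open Summit.ValiantsHypothesis.ValiantsHypothesis.Theorems.SymPencilPerFourBlocksThree

variable {K : Type*} [Field K]

/-- **Case B3, dimension-free structure**: the column of the zero cell vanishes, the row-kernel is
perm-isotropic, and it has codimension `3`.  See the module docstring. [folklore] -/
theorem zero_cell_structure [CharZero K] {ι : Type*} [Fintype ι]
    (hι : Fintype.card ι < 6) (W : Submodule K (Fin 4 × Fin 4 → K))
    (hW3 : ∀ x ∈ W, ∀ (r c : Fin 3 → Fin 4), Function.Injective r → Function.Injective c →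
      ((Matrix.of fun i j => x (i, j)).submatrix r c).permanent = 0)
    (hW : ∀ y ∈ W, ∃ (c : ι → K) (Λ : ι → ((Fin 4 × Fin 4 → K) →ₗ[K] K)),
      ∀ u : Fin 4 × Fin 4 → K, ∃ e₀ e₁ : K, ∀ s : K,
        eval (u + s • y) (perPoly (Fin 4) K) = e₀ + s * e₁ + s ^ 2 * ∑ k, c k * (Λ k u) ^ 2)
    (a m₁ : Fin 4) (hzero : ∀ x ∈ W, x (a, m₁) = 0)
    (hreal : ∀ v : Fin 4 → K, v m₁ = 0 → ∃ z ∈ W, ∀ j, z (a, j) = v j) :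
    (∀ x ∈ W, ∀ b, x (b, m₁) = 0) ∧
    (∀ y ∈ W, (∀ j, y (a, j) = 0) → ∀ i k j l : Fin 4, i ≠ k → j ≠ l →
      y (i, j) * y (k, l) + y (i, l) * y (k, j) = 0) ∧
    finrank K ↥(W ⊓ LinearMap.ker (LinearMap.funLeft K K fun j : Fin 4 => (a, j))) + 3 =
      finrank K W := by
  classical
  -- (0) unit rows `e_j` in row `a`, `j ≠ m₁`
  have hunit : ∀ j, j ≠ m₁ → ∃ z ∈ W, ∀ j', z (a, j') = (Pi.single j (1 : K) : Fin 4 → K) j' :=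
    fun j hj => hreal (Pi.single j 1) (Pi.single_eq_of_ne (Ne.symm hj) _)
  -- (1) the column `m₁` vanishes on `W`
  have hcol : ∀ x ∈ W, ∀ b, x (b, m₁) = 0 := by
    intro x hx b
    by_cases hba : b = a
    · rw [hba]; exact hzero x hx
    obtain ⟨c, hcm, hq⟩ := exists_perm_col_vanish_of_sum_sq_swap hι W hW a b m₁ (Ne.symm hba)
    have hprod : ∀ y ∈ W, y (a, c) * y (b, m₁) = 0 := fun y hy => by
      have h := hq y hy
      rwa [hzero y hy, zero_mul, add_zero] at h
    rcases forall_eq_zero_or_of_mul₂ W (linePoly_cell (a, c)) (linePoly_cell (b, m₁)) hprod with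
      h | h
    · obtain ⟨z, hz, hzv⟩ := hunit c hcm
      have := h z hz
      rw [hzv, Pi.single_eq_same] at this
      exact absurd this one_ne_zero
    · exact h x hx
  -- (2) on the row-kernel: all `2 × 2` subpermanents of rows `≠ a` vanish
  have hperm : ∀ x ∈ W, (∀ j, x (a, j) = 0) → ∀ b c : Fin 4, b ≠ a → c ≠ a → b ≠ c →
      ∀ j l : Fin 4, j ≠ l → x (b, j) * x (c, l) + x (b, l) * x (c, j) = 0 := by
    intro x hx hxa b c hba hca hbc j l hjl
    by_cases hjm : j = m₁
    · rw [hjm, hcol x hx c, hcol x hx b, mul_zero, zero_mul, add_zero]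
    by_cases hlm : l = m₁
    · rw [hlm, hcol x hx c, hcol x hx b, mul_zero, zero_mul, add_zero]
    obtain ⟨k, hkm, hkj, hkl⟩ := exists_fourth m₁ j l
    obtain ⟨z, hz, hzv⟩ := hunit k hkm
    have hzk : z (a, k) = 1 := by rw [hzv, Pi.single_eq_same]
    have hzj : z (a, j) = 0 := by rw [hzv, Pi.single_eq_of_ne (Ne.symm hkj)]
    have hzl : z (a, l) = 0 := by rw [hzv, Pi.single_eq_of_ne (Ne.symm hkl)]
    have hinjr : Function.Injective ![a, b, c] := injective_vec_three hba.symm hca.symm hbc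
    have hinjc : Function.Injective ![k, j, l] := injective_vec_three hkj hkl hjl
    have P : ∀ t : K, (z (b, j) + t * x (b, j)) * (z (c, l) + t * x (c, l)) +
        (z (b, l) + t * x (b, l)) * (z (c, j) + t * x (c, j)) = 0 := by
      intro t
      have h := hW3 (z + t • x) (W.add_mem hz (W.smul_mem t hx)) ![a, b, c] ![k, j, l] hinjr hinjc
      rw [Matrix.permanent_fin_three_row] at h
      simp only [Matrix.submatrix_apply, Matrix.of_apply, Matrix.cons_val_zero, Matrix.cons_val_one,
        Matrix.cons_val, Pi.add_apply, Pi.smul_apply, smul_eq_mul, hzk, hzj, hzl, hxa,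
        mul_zero, add_zero, one_mul, zero_mul] at h
      linear_combination h
    have h0 := P 0
    have h1 := P 1
    have h2 := P (-1)
    have h3 : (2 : K) * (x (b, j) * x (c, l) + x (b, l) * x (c, j)) = 0 := by
      linear_combination h1 + h2 - 2 * h0
    exact (mul_eq_zero.1 h3).resolve_left two_ne_zero
  have hB : ∀ y ∈ W, (∀ j, y (a, j) = 0) → ∀ i k j l : Fin 4, i ≠ k → j ≠ l →
      y (i, j) * y (k, l) + y (i, l) * y (k, j) = 0 := by
    intro y hy hya i k j l hik hjl
    by_cases hi : i = a
    · rw [hi, hya, hya, zero_mul, zero_mul, add_zero]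
    by_cases hk : k = a
    · rw [hk, hya, hya, mul_zero, mul_zero, add_zero]
    exact hperm y hy hya i k hi hk hik j l hjl
  -- (3) the row-kernel has codimension `3`
  let ρ : (Fin 4 × Fin 4 → K) →ₗ[K] (Fin 4 → K) := LinearMap.funLeft K K fun j : Fin 4 => (a, j)
  have hρ : ∀ x j, ρ x j = x (a, j) := fun _ _ => rfl
  have hk3 : finrank K (LinearMap.ker (LinearMap.proj m₁ : (Fin 4 → K) →ₗ[K] K)) = 3 := by
    have hsurj : Function.Surjective (LinearMap.proj m₁ : (Fin 4 → K) →ₗ[K] K) :=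
      fun t => ⟨Pi.single m₁ t, by simp⟩
    have h := LinearMap.finrank_range_add_finrank_ker (LinearMap.proj m₁ : (Fin 4 → K) →ₗ[K] K)
    rw [LinearMap.range_eq_top.2 hsurj, finrank_top, Module.finrank_self,
      Module.finrank_fintype_fun_eq_card, Fintype.card_fin] at h
    omega
  have himage : W.map ρ = LinearMap.ker (LinearMap.proj m₁ : (Fin 4 → K) →ₗ[K] K) := by
    apply le_antisymm
    · rintro _ ⟨x, hx, rfl⟩
      rw [LinearMap.mem_ker, LinearMap.proj_apply, hρ]
      exact hzero x hx
    · intro v hv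
      rw [LinearMap.mem_ker, LinearMap.proj_apply] at hv
      obtain ⟨z, hz, hzv⟩ := hreal v hv
      exact ⟨z, hz, funext fun j => by rw [hρ, hzv]⟩
  have hdim := finrank_eq_finrank_map_add_finrank_inf_ker W ρ
  rw [himage, hk3] at hdim
  exact ⟨hcol, hB, by rw [hdim]; ring⟩

/-- **At dimension `5`** the row-kernel `W₀ = W ∩ {row a = 0}` of Case B3 is `2`-dimensional.
[folklore] -/
theorem finrank_rowKernel_of_five [CharZero K] {ι : Type*} [Fintype ι]
    (hι : Fintype.card ι < 6) (W : Submodule K (Fin 4 × Fin 4 → K))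
    (hW3 : ∀ x ∈ W, ∀ (r c : Fin 3 → Fin 4), Function.Injective r → Function.Injective c →
      ((Matrix.of fun i j => x (i, j)).submatrix r c).permanent = 0)
    (hW : ∀ y ∈ W, ∃ (c : ι → K) (Λ : ι → ((Fin 4 × Fin 4 → K) →ₗ[K] K)),
      ∀ u : Fin 4 × Fin 4 → K, ∃ e₀ e₁ : K, ∀ s : K,
        eval (u + s • y) (perPoly (Fin 4) K) = e₀ + s * e₁ + s ^ 2 * ∑ k, c k * (Λ k u) ^ 2)
    (a m₁ : Fin 4) (hzero : ∀ x ∈ W, x (a, m₁) = 0)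
    (hreal : ∀ v : Fin 4 → K, v m₁ = 0 → ∃ z ∈ W, ∀ j, z (a, j) = v j)
    (h5 : finrank K W = 5) :
    finrank K ↥(W ⊓ LinearMap.ker (LinearMap.funLeft K K fun j : Fin 4 => (a, j))) = 2 := by
  have h := (zero_cell_structure hι W hW3 hW a m₁ hzero hreal).2.2
  omega

end Summit.ValiantsHypothesis.ValiantsHypothesis.Theorems.SymPencilPerFourZeroCellStructure

end
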